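import Literature.Barriers.CriticalPhenomena.LaceExpansionIsingExpansionBounds
import Literature.Probability.LatticeModels.IsingLaceCoefficients
import HarnessLib

/-!
# Sakai's coefficients on the boxes of the spread-out model: `Sakai2007_laceExpansionBounds`
# from Proposition 1.1 (for the concrete coefficients) and Proposition 3.1 (named fact)

Barrier catalogue `Literature/Barriers/CriticalPhenomena/` (D-0021), companion of
`LaceExpansionIsingExpansionBounds.lean` (the existential named fact
`Sakai2007_laceExpansionBounds` = Prop. 1.1 ∧ Prop. 3.1 of Sakai 2007 on boxes, and the proof
that it yields `Sakai2007_isingAssumptionH`) and of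
`Literature/Probability/LatticeModels/IsingLaceCoefficients.lean` (Sakai's coefficients
`π^{(j)}_Λ`, `R^{(j)}_Λ` of §2.2 on a finite graph, and Prop. 1.1 for them as the named fact
`IsingLace.Sakai2007_prop11`). Here the finite graph is the range-`L` graph induced on the box
`Λ_n` (`boxGraph`), the coefficients are transported to functions on `ℤ^d` vanishing off the box
(`sakaiPi`, `sakaiR`), Proposition 3.1 is re-stated for THESE coefficients
(`Sakai2007_prop31`, named fact — the deep part: the corrected diagrammatic bounds of
Sakai 2022 and the convolution bounds of §5.1), and it is PROVED that
`IsingLace.Sakai2007_prop11 → Sakai2007_prop31 → Sakai2007_laceExpansionBounds`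
(`isLaceExpansion_sakai`: Prop. 1.1 on the induced graph is `IsLaceExpansion` on the box, by
transport of the free-boundary two-point functions along the inclusion `Λ_n ↪ ℤ^d` and the
identification of directed bonds with ordered adjacent pairs). This splits the existential fact
into two named facts about explicit objects, the first of which (the expansion identity) is
finite combinatorics of random currents.

## References

* A. Sakai, *Lace expansion for the Ising model*, Comm. Math. Phys. 272 (2007) 283–344,
  arXiv:math-ph/0510093: Proposition 1.1 ((1.11)–(1.13)), §2.2 ((2.36)–(2.40)),
  Proposition 3.1 ((3.2)–(3.3)) [Sakai2007].
(Equation numbers are those of the arXiv version held in the literature store, every display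
counted.)
* A. Sakai, Comm. Math. Phys. 392 (2022) 783–823, arXiv:2003.09856: Theorems 3.1/3.4/3.7/3.11,
  Corollaries 3.3/3.10/3.14 [Sakai2022].
-/

noncomputable section

namespace Literature.Barriers.CriticalPhenomena.SpreadOutIsing

open Finset Literature.Probability.LatticeModels Literature.Probability.LatticeModels.IsingLace
open scoped BigOperators

variable {d L : ℕ}

/-! ## The finite graph of a box and the transported coefficients -/

/-- The range-`L` graph induced on the box `Λ_n` — Sakai's finite graph `(Λ, 𝔹_Λ)` for
`Λ = {-n,…,n}^d` ("For example, `Λ` is a `d`-dimensional hypercube centered at the origin").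
[cite: Sakai2007, §1.1 and §2.1] -/
def boxGraph (d L n : ℕ) : SimpleGraph (box d n) where
  Adj a b := (spreadOutGraph d L).Adj a.1 b.1
  symm := ⟨fun _ _ h => h.symm⟩
  loopless := ⟨fun a h => (spreadOutGraph d L).loopless.irrefl a.1 h⟩

/-- Adjacency in the box graph is decidable. [folklore] -/
instance (d L n : ℕ) : DecidableRel (boxGraph d L n).Adj := fun a b =>
  inferInstanceAs (Decidable ((spreadOutGraph d L).Adj a.1 b.1))

/-- The origin as a vertex of the box. [folklore] -/
def boxOrigin (d n : ℕ) : box d n := ⟨0, zero_mem_box d n⟩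

/-- **Sakai's coefficients `π^{(j)}_{p;Λ_n}(x)` of the spread-out model on the box `Λ_n`**, as a
function on `ℤ^d` vanishing off the box. [cite: Sakai2007, (2.36) and (2.39)] -/
def sakaiPi (d L : ℕ) (β : ℝ) (n : ℕ) (j : ℕ) (x : Site d) : ℝ :=
  if hx : x ∈ box d n then IsingLace.coeff (boxGraph d L n) β (boxOrigin d n) j ⟨x, hx⟩ else 0

/-- **Sakai's remainders `R^{(j)}_{p;Λ_n}(x)`** on the box, extended by zero. [cite: Sakai2007, (2.37) and (2.40)] -/
def sakaiR (d L : ℕ) (β : ℝ) (n : ℕ) (j : ℕ) (x : Site d) : ℝ :=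
  if hx : x ∈ box d n then IsingLace.remainder (boxGraph d L n) β (boxOrigin d n) j ⟨x, hx⟩ else 0

/-! ## Proposition 3.1 for the concrete coefficients (named fact) -/

/-- NAMED FACT — **Sakai 2007, Proposition 3.1 (`x`-space bounds (3.3)) for Sakai's own
coefficients `π^{(i)}_{p;Λ_n}` on the boxes of the uniformly spread-out model, `q = d - 2`,
`d > 4`** (diagrammatic bounds as corrected in Sakai 2022), with the quantifier structure and
transcription choices of `Sakai2007_laceExpansionBounds` (to which it is the second input): under
`τ ≤ 2` and `G_β(x) ≤ δ_{o,x} + θ₀⟦x⟧^{-(d-2)}`, for `θ₀ ≤ θ₁` with `θ₀L² ≥ c₀` and `L ≥ L₀`,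
`LaceCoeffBounds d C θ₀ n (sakaiPi d L β n)`. The deep part of Sakai's work (§§4–5 of 2007 with
the diagrammatic bounds of Sakai 2022, Theorems 3.1/3.4/3.7/3.11); not proved here.
[cite: Sakai2007, Proposition 3.1, (3.2)–(3.3), §5.1]
[cite: Sakai2022, Theorems 3.1/3.4/3.7/3.11, Lemma 3.2, Corollaries 3.3/3.10/3.14] -/
def Sakai2007_prop31 : Prop :=
  ∀ d : ℕ, 4 < d → ∀ c₀ : ℝ, 0 < c₀ → ∃ θ₁ : ℝ, 0 < θ₁ ∧ ∃ C : ℝ, 0 < C ∧ ∃ L₀ : ℕ, 1 ≤ L₀ ∧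
    ∀ L : ℕ, L₀ ≤ L → ∀ θ₀ : ℝ, 0 < θ₀ → θ₀ ≤ θ₁ → c₀ ≤ θ₀ * (L : ℝ) ^ 2 →
      ∀ β : ℝ, 0 ≤ β → isingZ d L β ≤ 2 →
        (∀ x : Site d, spreadOutTwoPoint d L β x ≤ delta0 x + θ₀ * jnorm x ^ (-((d : ℝ) - 2))) →
          ∀ n : ℕ, LaceCoeffBounds d C θ₀ n (sakaiPi d L β n)

/-! ## Transport: Proposition 1.1 on the induced graph is `IsLaceExpansion` on the box -/

/-- The whole vertex set of the box graph is the box. [folklore] -/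
theorem univ_map_subtype_box (d n : ℕ) :
    (univ : Finset (box d n)).map (Function.Embedding.subtype _) = box d n := by
  ext y
  simp only [Finset.mem_map, Finset.mem_univ, true_and, Function.Embedding.coe_subtype]
  exact ⟨fun ⟨a, ha⟩ => ha ▸ a.2, fun hy => ⟨⟨y, hy⟩, rfl⟩⟩

/-- **Transport of the two-point functions**: the free two-point function of the induced finite
graph is the box two-point function, `⟨φ_aφ_b⟩_{(Λ_n, 𝔹_{Λ_n})} = ⟨φ_aφ_b⟩_{Λ_n}`. [folklore] -/
theorem isingTwoPoint_boxGraph (β : ℝ) (n : ℕ) (a b : box d n) :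
    isingTwoPoint (boxGraph d L n) univ β 0 .free a b = boxPair d L β n a.1 b.1 := by
  have h := isingTwoPoint_free_map (G := boxGraph d L n) (G' := spreadOutGraph d L)
    (Function.Embedding.subtype _) (Λ := univ) (fun x _ y _ => Iff.rfl) β 0 a b
  rw [univ_map_subtype_box] at h
  exact h.symm

/-- Sums over directed bonds of the box graph are sums over ordered adjacent pairs of the box.
[folklore] -/
theorem sum_dart_boxGraph (n : ℕ) (f : Site d → Site d → ℝ) :
    ∑ e : (boxGraph d L n).Dart, f e.fst.1 e.snd.1 =
      ∑ u ∈ box d n, ∑ v ∈ box d n, if (spreadOutGraph d L).Adj u v then f u v else 0 := by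
  classical
  set W := box d n
  -- darts ≃ adjacent ordered pairs
  let e : (boxGraph d L n).Dart ≃ {p : W × W // (boxGraph d L n).Adj p.1 p.2} :=
    { toFun := fun dd => ⟨dd.toProd, dd.adj⟩
      invFun := fun p => ⟨p.1, p.2⟩
      left_inv := fun _ => rfl
      right_inv := fun _ => rfl }
  calc ∑ e : (boxGraph d L n).Dart, f e.fst.1 e.snd.1
      = ∑ p : {p : W × W // (boxGraph d L n).Adj p.1 p.2}, f p.1.1.1 p.1.2.1 := by
        rw [← Equiv.sum_comp e.symm]
        rfl
    _ = ∑ p ∈ (univ : Finset (W × W)).filter (fun p => (boxGraph d L n).Adj p.1 p.2),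
          f p.1.1 p.2.1 := (Finset.sum_subtype _ (fun p => by simp) (fun p : W × W => f p.1.1 p.2.1)).symm
    _ = ∑ p : W × W, if (boxGraph d L n).Adj p.1 p.2 then f p.1.1 p.2.1 else 0 := Finset.sum_filter _ _
    _ = ∑ a : W, ∑ b : W, if (spreadOutGraph d L).Adj a.1 b.1 then f a.1 b.1 else 0 := by
        rw [← Finset.univ_product_univ, Finset.sum_product]
        rfl
    _ = ∑ u ∈ box d n, ∑ v ∈ box d n, if (spreadOutGraph d L).Adj u v then f u v else 0 := by
        rw [← Finset.sum_coe_sort (box d n)]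
        refine Finset.sum_congr rfl fun a _ => ?_
        exact Finset.sum_coe_sort (box d n) (fun v => if (spreadOutGraph d L).Adj a.1 v then f a.1 v else 0)

/-- On the box, `sakaiPi` is Sakai's coefficient of the induced graph. [folklore] -/
theorem sakaiPi_of_mem (β : ℝ) (n j : ℕ) {x : Site d} (hx : x ∈ box d n) :
    sakaiPi d L β n j x = IsingLace.coeff (boxGraph d L n) β (boxOrigin d n) j ⟨x, hx⟩ := dif_pos hx

/-- On the box, `sakaiR` is Sakai's remainder of the induced graph. [folklore] -/
theorem sakaiR_of_mem (β : ℝ) (n j : ℕ) {x : Site d} (hx : x ∈ box d n) :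
    sakaiR d L β n j x = IsingLace.remainder (boxGraph d L n) β (boxOrigin d n) j ⟨x, hx⟩ := dif_pos hx

/-- On the box, the alternating sums `lacePi (sakaiPi …)` are Sakai's `Π^{(j)}_Λ` of the induced
graph. [cite: Sakai2007, (1.12)] -/
theorem lacePi_sakaiPi_of_mem (β : ℝ) (n j : ℕ) {x : Site d} (hx : x ∈ box d n) :
    lacePi (sakaiPi d L β n) j x = IsingLace.coeffSum (boxGraph d L n) β (boxOrigin d n) j ⟨x, hx⟩ := by
  unfold lacePi IsingLace.coeffSum
  exact Finset.sum_congr rfl fun i _ => by rw [sakaiPi_of_mem β n i hx]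

/-- A dart sum of the expansion against the box bond variables:
`Σ_{(u,v)} F(u) tanh β ⟨φ_vφ_x⟩ = Σ_{u,v ∈ Λ_n} F(u) τ_{u,v} ⟨φ_vφ_x⟩_{Λ_n}`. [folklore] -/
theorem sum_dart_mul_tanh_mul_twoPoint (β : ℝ) (n : ℕ) (F : Site d → ℝ) {x : Site d} (hx : x ∈ box d n)
    (Fbox : box d n → ℝ) (hF : ∀ a : box d n, Fbox a = F a.1) :
    ∑ e : (boxGraph d L n).Dart, Fbox e.fst * Real.tanh β *
        isingTwoPoint (boxGraph d L n) univ β 0 .free e.snd ⟨x, hx⟩ =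
      ∑ u ∈ box d n, ∑ v ∈ box d n, F u * tauBond d L β u v * boxPair d L β n v x := by
  have h := sum_dart_boxGraph (d := d) (L := L) n (fun u v => F u * Real.tanh β * boxPair d L β n v x)
  have hlhs : ∑ e : (boxGraph d L n).Dart, Fbox e.fst * Real.tanh β *
      isingTwoPoint (boxGraph d L n) univ β 0 .free e.snd ⟨x, hx⟩ =
      ∑ e : (boxGraph d L n).Dart, F e.fst.1 * Real.tanh β * boxPair d L β n e.snd.1 x :=
    Finset.sum_congr rfl fun e _ => by rw [hF, isingTwoPoint_boxGraph]
  rw [hlhs, h]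
  refine Finset.sum_congr rfl fun u _ => Finset.sum_congr rfl fun v _ => ?_
  unfold tauBond
  split_ifs <;> ring

/-- **Proposition 1.1 on the induced finite graph is `IsLaceExpansion` on the box**: the identity
(1.11) and the bounds (1.13) for Sakai's coefficients of `(Λ_n, 𝔹_{Λ_n})` are, after transport of
the free two-point functions along `Λ_n ↪ ℤ^d`, the predicate consumed by
`Sakai2007_laceExpansionBounds`. [cite: Sakai2007, Proposition 1.1, (1.11)–(1.13)] -/
theorem isLaceExpansion_sakai (h11 : IsingLace.Sakai2007_prop11) {β : ℝ} (hβ : 0 ≤ β) (n : ℕ) :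
    IsLaceExpansion d L β n (sakaiPi d L β n) (sakaiR d L β n) := by
  have H := h11 (box d n) (boxGraph d L n) β hβ (boxOrigin d n)
  refine ⟨fun j x hx => ?_, fun j x hx => ?_, fun j x hx => ?_, fun j x hx => ?_⟩
  · obtain ⟨hid, -, -, -⟩ := H j ⟨x, hx⟩
    have h0 : boxTwoPoint d L β n x = isingTwoPoint (boxGraph d L n) univ β 0 .free (boxOrigin d n) ⟨x, hx⟩ := by
      rw [isingTwoPoint_boxGraph]; rfl
    rw [h0, hid, lacePi_sakaiPi_of_mem β n j hx, sakaiR_of_mem β n (j + 1) hx,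
      sum_dart_mul_tanh_mul_twoPoint β n (lacePi (sakaiPi d L β n) j) hx
        (fun a => IsingLace.coeffSum (boxGraph d L n) β (boxOrigin d n) j a)
        (fun a => (lacePi_sakaiPi_of_mem β n j a.2).symm)]
  · obtain ⟨-, hge, -, -⟩ := H j ⟨x, hx⟩
    rw [sakaiPi_of_mem β n j hx]
    refine le_trans (le_of_eq ?_) hge
    unfold delta0
    have hx0 : (⟨x, hx⟩ : box d n) = boxOrigin d n ↔ x = 0 := by
      rw [boxOrigin, Subtype.ext_iff]
    by_cases hj : j = 0
    · by_cases h0 : x = 0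
      · rw [if_pos h0, if_pos hj, if_pos ⟨hj, hx0.2 h0⟩]
      · rw [if_neg h0, if_pos hj, if_neg (fun h => h0 (hx0.1 h.2))]
    · rw [if_neg hj, if_neg (fun h => hj h.1)]
  · obtain ⟨-, -, hR0, -⟩ := H j ⟨x, hx⟩
    rwa [sakaiR_of_mem β n (j + 1) hx]
  · obtain ⟨-, -, -, hRle⟩ := H j ⟨x, hx⟩
    rw [sakaiR_of_mem β n (j + 1) hx]
    refine hRle.trans (le_of_eq ?_)
    exact sum_dart_mul_tanh_mul_twoPoint β n (sakaiPi d L β n j) hx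
      (fun a => IsingLace.coeff (boxGraph d L n) β (boxOrigin d n) j a)
      (fun a => (sakaiPi_of_mem β n j a.2).symm)

/-! ## The split of the existential fact -/

/-- **`Sakai2007_laceExpansionBounds` from Proposition 1.1 (for the concrete coefficients) and
Proposition 3.1 (named fact)**: the witnesses are Sakai's own `π^{(j)}_{p;Λ_n}`, `R^{(j)}_{p;Λ_n}`.
[cite: Sakai2007, Propositions 1.1 and 3.1] -/
theorem Sakai2007_laceExpansionBounds_of_prop11_prop31 (h11 : IsingLace.Sakai2007_prop11)
    (h31 : Sakai2007_prop31) : Sakai2007_laceExpansionBounds := by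
  intro d hd c₀ hc₀
  obtain ⟨θ₁, hθ₁, C, hC, L₀, hL₀, H⟩ := h31 d hd c₀ hc₀
  refine ⟨θ₁, hθ₁, C, hC, L₀, hL₀, fun L hL θ₀ hθ hθθ₁ hcθ β hβ hτ hG n => ?_⟩
  exact ⟨sakaiPi d L β n, sakaiR d L β n, isLaceExpansion_sakai h11 hβ n,
    H L hL θ₀ hθ hθθ₁ hcθ β hβ hτ hG n⟩

/-- **Liu–Slade's Assumption 1.5 for the spread-out Ising model from Sakai's Propositions 1.1
and 3.1 about his explicit coefficients.** [cite: Sakai2007, Propositions 1.1, 1.2, 3.1 and (1.18)]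
[cite: LiuSlade2026, Assumption 1.5 and §1.2.2] -/
theorem Sakai2007_isingAssumptionH_of_prop11_prop31 (h11 : IsingLace.Sakai2007_prop11)
    (h31 : Sakai2007_prop31) : Sakai2007_isingAssumptionH :=
  Sakai2007_isingAssumptionH_of_laceExpansionBounds
    (Sakai2007_laceExpansionBounds_of_prop11_prop31 h11 h31)

end Literature.Barriers.CriticalPhenomena.SpreadOutIsing

end
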